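import Summits.AtomisticToContinuum.Crystallization.Theorems.OverbindingBudgetImprovementTransferLemmas

/-!
# OverbindingBudget — the local relaxation test, IV: transfer of an improving surgery; `LocalRelaxationTest` PROVED (lens-4 g28)

`improvementTransfer_holds : ImprovementTransfer T₀ D` — in the clean class (uniformly discrete, uniformly recurrent, relatively dense)
ONE improving surgery `(F₀, G₀)` with gain `g₀ > 0` gives `DenseImprovementT Y` with gain `g₀/4`:
* base truncation (the only tail estimate): `truncGain F₀ G₀ (Y ∩ B̄(0,r)) ≥ g₀/2` for `r ≥ ρ₀` (`finiteGain_eq` + dyadic tails);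
* for `ρ ≥ ρ₀`: a window-free cut radius `r ∈ [ρ, 2ρ]` (pigeonhole over `#(Y ∩ B̄(0, 2ρ+1)) + 1` shells), an `ε`-matching of radius
  `2ρ + 2` from uniform recurrence near every point (covering radius `9/10`), the partner map `φ` (injective by `2ε < δ`), the transported
  patch `(φ(F₀), G₀ + g, φ(Y ∩ B̄(0,r)) = Y ∩ B̄(g, r))` (exact window correspondence thanks to the atom-free shell `| ‖w‖ − r | < 3ε`),
  disjointness of `G₀ + g` from `Y ∖ φ(F₀)` (`ε < dist(G₀, Y ∖ F₀)/2`), and the term-by-term Lipschitz comparison of the four finite sums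
  (`|V(s) − V(t)| ≤ (m⁻¹³ + m⁻⁷)|s − t|`), error `≤ ε K ≤ g₀/4`.
Hence **`localRelaxationTest_holds : LocalRelaxationTest T₀ D` for all `T₀, D`** (part III), in particular the RDEF-cone hypothesis
`LocalRelaxationTest (1/250) 10` of `rdef_of_grossU_shearSplit_record`.
-/

noncomputable section

open Metric Set
open scoped BigOperators
open Literature.MathematicalPhysics.StatisticalMechanics
open Summit.AtomisticToContinuum.Crystallization.Theorems.OverbindingBudgetEdgeRelaxationStatements
open Summit.AtomisticToContinuum.Crystallization.Theorems.OverbindingBudgetRecurrentSealStatements (UniformlyRecurrent)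
open Summit.AtomisticToContinuum.Crystallization.Theorems.OverbindingBudgetElasticSplitStatements (surgeryGain LocallyOptimal LocalRelaxationTest)
open Summit.AtomisticToContinuum.Crystallization.Theorems.OverbindingBudgetCubeTails
open Summit.AtomisticToContinuum.Crystallization.Theorems.OverbindingBudgetPatchContinuity (abs_lennardJones_sub_le)
open Summit.AtomisticToContinuum.Crystallization.Theorems.OverbindingBudgetLocalRelaxationCut
open Summit.AtomisticToContinuum.Crystallization.Theorems.OverbindingBudgetLocalRelaxationTrunc
open Summit.AtomisticToContinuum.Crystallization.Theorems.OverbindingBudgetImprovementTransferLemmas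

namespace Summit.AtomisticToContinuum.Crystallization.Theorems.OverbindingBudgetImprovementTransfer

/-! ## The transfer theorem -/

set_option maxHeartbeats 4000000 in
/-- **Piece A′: one improving surgery recurs, with truncated gains, near every point and at every truncation scale.** [this file] -/
theorem improvementTransfer_holds (T₀ D : ℝ) : ImprovementTransfer T₀ D := by
  intro Y hW hnot
  obtain ⟨hUD, h0Y, hrec, hcov, -, -⟩ := hW
  obtain ⟨δ₀, hδ₀, hsep₀⟩ := id hUD
  set δ : ℝ := min δ₀ 1 with hδdef
  have hδ : 0 < δ := lt_min hδ₀ one_pos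
  have hδ1 : δ ≤ 1 := min_le_right _ _
  have hsep : ∀ x ∈ Y, ∀ y ∈ Y, x ≠ y → δ ≤ dist x y := fun x hx y hy hxy => (min_le_left _ _).trans (hsep₀ x hx y hy hxy)
  -- the improving surgery
  unfold LocallyOptimal at hnot
  push Not at hnot
  obtain ⟨F₀, G₀, hF₀Y, hcard₀, hdisj₀, hgain₀⟩ := hnot
  set g₀ : ℝ := surgeryGain Y F₀ G₀ with hg₀def
  -- base radius
  set R₀ : ℝ := 1 + ∑ a ∈ F₀ ∪ G₀, ‖a‖ with hR₀def
  have hnorm : ∀ a ∈ F₀ ∪ G₀, ‖a‖ ≤ R₀ - 1 := by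
    intro a ha
    have := Finset.single_le_sum (f := fun a : EuclideanSpace ℝ (Fin 3) => ‖a‖) (fun b _ => norm_nonneg b) ha
    linarith
  have hFn : ∀ a ∈ F₀, ‖a‖ ≤ R₀ - 1 := fun a ha => hnorm a (Finset.mem_union_left _ ha)
  have hGn : ∀ a ∈ G₀, ‖a‖ ≤ R₀ - 1 := fun a ha => hnorm a (Finset.mem_union_right _ ha)
  have hR₀1 : 1 ≤ R₀ := by
    have : 0 ≤ ∑ a ∈ F₀ ∪ G₀, ‖a‖ := Finset.sum_nonneg fun a _ => norm_nonneg a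
    linarith
  -- constants of the base truncation
  set γc : ℝ := 432 * (δ⁻¹ ^ 6 + 1) * δ⁻¹ ^ 3 with hγcdef
  have hγc : 0 ≤ γc := by positivity
  set ρ₀ : ℝ := R₀ + 1 + 4 * F₀.card * γc / g₀ with hρ₀def
  have hFγg : 0 ≤ 4 * F₀.card * γc / g₀ := by positivity
  have hρ₀R : R₀ + 1 ≤ ρ₀ := by linarith
  have hρ₀ : 0 < ρ₀ := by linarith
  -- (T) base truncation: truncGain ≥ g₀/2 at every radius r ≥ ρ₀
  have hT : ∀ r : ℝ, ρ₀ ≤ r → ∀ W₀ : Finset (EuclideanSpace ℝ (Fin 3)),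
      (↑W₀ : Set (EuclideanSpace ℝ (Fin 3))) = Y ∩ Metric.closedBall 0 r → g₀ / 2 ≤ truncGain F₀ G₀ W₀ := by
    intro r hr W₀ hW₀
    have hW₀Y : (↑W₀ : Set (EuclideanSpace ℝ (Fin 3))) ⊆ Y := hW₀ ▸ Set.inter_subset_left
    have hF₀W₀ : F₀ ⊆ W₀ := by
      intro y hy
      rw [← Finset.mem_coe, hW₀]
      exact ⟨hF₀Y (Finset.mem_coe.2 hy), Metric.mem_closedBall.2 (by rw [dist_zero_right]; linarith [hFn y hy])⟩
    have hout : ∀ z ∈ Y, z ∉ W₀ → r < ‖z‖ := by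
      intro z hz hzW
      by_contra hle
      exact hzW (by rw [← Finset.mem_coe, hW₀]; exact ⟨hz, Metric.mem_closedBall.2 (by rw [dist_zero_right]; exact not_lt.1 hle)⟩)
    have hb := truncGain_ge_base hUD hδ hsep hF₀W₀ hW₀Y hcard₀ (R₁ := R₀ - 1) (r := r) (by linarith) hFn hGn hout
    -- tails: 2 #F₀ γc u⁻³ ≤ g₀/2 with u = r − R₀ + 1 ≥ 4 #F₀ γc / g₀ and ≥ 1
    have hu1 : 1 ≤ r - (R₀ - 1) := by linarith
    have hu0 : 0 ≤ (r - (R₀ - 1))⁻¹ := inv_nonneg.2 (by linarith)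
    have hv1 : (r - (R₀ - 1))⁻¹ ≤ 1 := inv_le_one_of_one_le₀ hu1
    have hv3 : (r - (R₀ - 1))⁻¹ ^ 3 ≤ (r - (R₀ - 1))⁻¹ := by
      have := pow_le_pow_of_le_one hu0 hv1 (by norm_num : 1 ≤ 3)
      rwa [pow_one] at this
    have hmain : 4 * F₀.card * γc * (r - (R₀ - 1))⁻¹ ≤ g₀ := by
      rw [← div_eq_mul_inv, div_le_iff₀ (by linarith : (0 : ℝ) < r - (R₀ - 1))]
      have h4 : 4 * F₀.card * γc / g₀ ≤ r - (R₀ - 1) := by linarith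
      rw [div_le_iff₀ hgain₀] at h4
      linarith [mul_comm g₀ (r - (R₀ - 1))]
    have h3 : 4 * F₀.card * γc * (r - (R₀ - 1))⁻¹ ^ 3 ≤ 4 * F₀.card * γc * (r - (R₀ - 1))⁻¹ :=
      mul_le_mul_of_nonneg_left hv3 (by positivity)
    have e : 2 * (F₀.card : ℝ) * (432 * (δ⁻¹ ^ 6 + 1) * δ⁻¹ ^ 3 * (r - (R₀ - 1))⁻¹ ^ 3) =
        (4 * F₀.card * γc * (r - (R₀ - 1))⁻¹ ^ 3) / 2 := by rw [hγcdef]; ring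
    rw [e] at hb
    linarith
  -- the data of `DenseImprovementT`: gain g₀/4, radius R₀, threshold ρ₀
  refine ⟨g₀ / 4, by positivity, R₀, by linarith, ρ₀, hρ₀, fun ρ hρ => ?_⟩
  have hρpos : 0 < ρ := hρ₀.trans_le hρ
  have hRρ : R₀ + 1 ≤ ρ := hρ₀R.trans hρ
  -- the big base window and the constants depending on ρ
  have hfinb := hUD.finite_inter_closedBall 0 (2 * ρ + 1)
  set Wb : Finset (EuclideanSpace ℝ (Fin 3)) := hfinb.toFinset with hWbdef
  have hWb : (↑Wb : Set (EuclideanSpace ℝ (Fin 3))) = Y ∩ Metric.closedBall 0 (2 * ρ + 1) := hfinb.coe_toFinset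
  have hmemWb : ∀ w, w ∈ Wb ↔ w ∈ Y ∧ ‖w‖ ≤ 2 * ρ + 1 := by
    intro w
    rw [← Finset.mem_coe, hWb, Set.mem_inter_iff, Metric.mem_closedBall, dist_zero_right]
  obtain ⟨j, hjN, hfree⟩ := exists_free_shell Wb hρpos
  set N : ℕ := Wb.card with hNdef
  -- distance of G₀ from Y ∖ F₀
  obtain ⟨ρG, hρG, hρG1, hρGd⟩ := exists_pos_le_dist G₀ (Wb \ F₀) (by
    intro x hx w hw hxw
    rw [Finset.mem_sdiff] at hw
    have hwY : w ∈ Y := ((hmemWb w).1 hw.1).1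
    exact Set.disjoint_left.1 hdisj₀ (Finset.mem_coe.2 hx) (hxw ▸ ⟨hwY, fun h => hw.2 (Finset.mem_coe.1 h)⟩))
  have hρGY : ∀ x ∈ G₀, ∀ w ∈ Y, w ∉ F₀ → ρG ≤ dist x w := by
    intro x hx w hwY hwF
    by_cases hwb : w ∈ Wb
    · exact hρGd x hx w (Finset.mem_sdiff.2 ⟨hwb, hwF⟩)
    · have hwn : 2 * ρ + 1 < ‖w‖ := by
        by_contra hle
        exact hwb ((hmemWb w).2 ⟨hwY, not_lt.1 hle⟩)
      have h1 : ‖w‖ - ‖x‖ ≤ ‖w - x‖ := norm_sub_norm_le w x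
      rw [dist_comm, dist_eq_norm]
      linarith [hGn x hx]
  -- Lipschitz constants and the error budget
  set L : ℝ := δ⁻¹ ^ 13 + δ⁻¹ ^ 7 with hLdef
  have hL : 0 ≤ L := by positivity
  set LG : ℝ := (ρG / 2)⁻¹ ^ 13 + (ρG / 2)⁻¹ ^ 7 with hLGdef
  have hLG : 0 ≤ LG := by positivity
  set K : ℝ := F₀.card * F₀.card * L + 2 * F₀.card * N * L + F₀.card * N * LG with hKdef
  have hK : 0 ≤ K := by positivity
  set ω : ℝ := ρ / (N + 1) with hωdef
  have hω : 0 < ω := by positivity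
  set ε : ℝ := min (min (δ / 4) (ρG / 2)) (min (ω / 6) (g₀ / (4 * (K + 1)))) with hεdef
  have hε : 0 < ε := lt_min (lt_min (by positivity) (by positivity)) (lt_min (by positivity) (by positivity))
  have hεδ : ε ≤ δ / 4 := (min_le_left _ _).trans (min_le_left _ _)
  have hεG : ε ≤ ρG / 2 := (min_le_left _ _).trans (min_le_right _ _)
  have hεω : ε ≤ ω / 6 := (min_le_right _ _).trans (min_le_left _ _)
  have hεK' : ε ≤ g₀ / (4 * (K + 1)) := (min_le_right _ _).trans (min_le_right _ _)
  have hεK : ε * K ≤ g₀ / 4 := by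
    rw [le_div_iff₀ (by linarith [hK] : (0 : ℝ) < 4 * (K + 1))] at hεK'
    have e : ε * (4 * (K + 1)) = 4 * (ε * K) + 4 * ε := by ring
    linarith [hε.le]
  have h2ε : 2 * ε < δ := by linarith
  have hε1 : ε ≤ 1 / 4 := by linarith
  -- the recurrence radius and the density
  set Rm : ℝ := 2 * ρ + 2 with hRmdef
  obtain ⟨Gd, hGd⟩ := hrec Rm ε hε
  have hGd0 : 0 ≤ Gd := by
    obtain ⟨g, -, hg0, -⟩ := hGd 0 h0Y
    exact dist_nonneg.trans hg0
  refine ⟨Gd + 9 / 10, by linarith, fun z => ?_⟩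
  obtain ⟨w₀, hw₀Y, hzw₀⟩ := hcov z
  obtain ⟨g, hgY, hgw₀, hM⟩ := hGd w₀ hw₀Y
  refine ⟨g, by linarith [dist_triangle g w₀ z, dist_comm z w₀], ?_⟩
  -- the window-free cut radius
  set r : ℝ := ρ + (j + 1 / 2) * ω with hrdef
  have hj0 : (0 : ℝ) ≤ j := Nat.cast_nonneg j
  have hjN' : (j : ℝ) ≤ N := by exact_mod_cast hjN
  have hρr : ρ ≤ r := by
    have : 0 ≤ ((j : ℝ) + 1 / 2) * ω := mul_nonneg (by linarith) hω.le
    rw [hrdef]; linarith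
  have hr2 : r ≤ 2 * ρ := by
    have h1 : (j + 1 / 2) * ω ≤ (N + 1) * ω := mul_le_mul_of_nonneg_right (by linarith) hω.le
    have h2 : (N + 1 : ℝ) * ω = ρ := by rw [hωdef]; field_simp
    rw [hrdef]; linarith
  have hgap : ∀ w ∈ Y, ‖w‖ < r - 3 * ε ∨ r + 3 * ε ≤ ‖w‖ := by
    intro w hwY
    by_cases hwb : ‖w‖ ≤ 2 * ρ + 1
    · rcases hfree w ((hmemWb w).2 ⟨hwY, hwb⟩) with h | h
      · left; rw [hrdef]; linarith
      · right; rw [hrdef]; linarith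
    · right; push Not at hwb; linarith
  -- matching facts
  have hM1 : ∀ s ∈ Y, ‖s‖ ≤ Rm → ∃ s' ∈ Y, dist s' (s + g) ≤ ε := by
    intro s hs hsR
    obtain ⟨_, ⟨s', hs', rfl⟩, hd⟩ := hM.1 s hs (by rwa [dist_zero_right])
    refine ⟨s', hs', ?_⟩
    rwa [← dist_sub_right s' (s + g) g, add_sub_cancel_right]
  have hM2 : ∀ a' ∈ Y, dist a' g ≤ Rm → ∃ s ∈ Y, dist a' (s + g) ≤ ε := by
    intro a' ha' haR
    obtain ⟨s, hs, hd⟩ := hM.2 (a' - g) ⟨a', ha', rfl⟩ (by rwa [dist_zero_right, ← dist_eq_norm])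
    refine ⟨s, hs, ?_⟩
    rwa [← dist_sub_right a' (s + g) g, add_sub_cancel_right]
  have hU1 : ∀ s₁ ∈ Y, ∀ s₂ ∈ Y, ∀ a : EuclideanSpace ℝ (Fin 3), dist a (s₁ + g) ≤ ε → dist a (s₂ + g) ≤ ε → s₁ = s₂ := by
    intro s₁ h₁ s₂ h₂ a ha₁ ha₂
    by_contra hne
    have hd := hsep s₁ h₁ s₂ h₂ hne
    have : dist s₁ s₂ ≤ 2 * ε := by
      rw [← dist_add_right s₁ s₂ g]
      linarith [dist_triangle (s₁ + g) a (s₂ + g), dist_comm a (s₁ + g)]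
    linarith
  have hU2 : ∀ a₁ ∈ Y, ∀ a₂ ∈ Y, ∀ s : EuclideanSpace ℝ (Fin 3), dist a₁ (s + g) ≤ ε → dist a₂ (s + g) ≤ ε → a₁ = a₂ := by
    intro a₁ h₁ a₂ h₂ s ha₁ ha₂
    by_contra hne
    have hd := hsep a₁ h₁ a₂ h₂ hne
    linarith [dist_triangle a₁ (s + g) a₂, dist_comm a₂ (s + g)]
  -- the partner map
  have hex : ∀ s : EuclideanSpace ℝ (Fin 3), ∃ s' : EuclideanSpace ℝ (Fin 3), s ∈ Y → ‖s‖ ≤ Rm → s' ∈ Y ∧ dist s' (s + g) ≤ ε := by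
    intro s
    by_cases h : s ∈ Y ∧ ‖s‖ ≤ Rm
    · obtain ⟨s', hs', hd⟩ := hM1 s h.1 h.2
      exact ⟨s', fun _ _ => ⟨hs', hd⟩⟩
    · exact ⟨s, fun h1 h2 => absurd ⟨h1, h2⟩ h⟩
  choose φ hφ using hex
  -- the base window
  have hfin0 := hUD.finite_inter_closedBall 0 r
  set W₀ : Finset (EuclideanSpace ℝ (Fin 3)) := hfin0.toFinset with hW₀def
  have hW₀ : (↑W₀ : Set (EuclideanSpace ℝ (Fin 3))) = Y ∩ Metric.closedBall 0 r := hfin0.coe_toFinset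
  have hmemW₀ : ∀ w, w ∈ W₀ ↔ w ∈ Y ∧ ‖w‖ ≤ r := by
    intro w
    rw [← Finset.mem_coe, hW₀, Set.mem_inter_iff, Metric.mem_closedBall, dist_zero_right]
  have hF₀W₀ : F₀ ⊆ W₀ := fun y hy => (hmemW₀ y).2 ⟨hF₀Y (Finset.mem_coe.2 hy), by linarith [hFn y hy]⟩
  have hW₀Wb : W₀ ⊆ Wb := fun w hw => (hmemWb w).2 ⟨((hmemW₀ w).1 hw).1, by linarith [((hmemW₀ w).1 hw).2]⟩
  have hcardW : ((W₀ \ F₀).card : ℝ) ≤ N := by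
    rw [hNdef]; exact_mod_cast (Finset.card_le_card Finset.sdiff_subset).trans (Finset.card_le_card hW₀Wb)
  have hφW : ∀ s ∈ W₀, φ s ∈ Y ∧ dist (φ s) (s + g) ≤ ε := fun s hs =>
    hφ s ((hmemW₀ s).1 hs).1 (by linarith [((hmemW₀ s).1 hs).2])
  have hinjW : Set.InjOn φ ↑W₀ := by
    intro s₁ h₁ s₂ h₂ heq
    have h₁' := hφW s₁ (Finset.mem_coe.1 h₁)
    have h₂' := hφW s₂ (Finset.mem_coe.1 h₂)
    exact hU1 s₁ ((hmemW₀ s₁).1 (Finset.mem_coe.1 h₁)).1 s₂ ((hmemW₀ s₂).1 (Finset.mem_coe.1 h₂)).1 (φ s₁) h₁'.2 (heq ▸ h₂'.2)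
  have hinjF : Set.InjOn φ ↑F₀ := hinjW.mono (Finset.coe_subset.2 hF₀W₀)
  have hinjτ : Function.Injective (fun x : EuclideanSpace ℝ (Fin 3) => x + g) := add_left_injective g
  -- the transported patch
  refine ⟨r, hρr, hr2, F₀.image φ, G₀.image (fun x => x + g), W₀.image φ, ?_, ?_, ?_, ?_, ?_, ?_, ?_⟩
  · -- F ⊆ Y
    intro y' hy'
    obtain ⟨y, hy, rfl⟩ := Finset.mem_image.1 (Finset.mem_coe.1 hy')
    exact (hφW y (hF₀W₀ hy)).1
  · -- F ⊆ B̄(g, R₀)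
    intro y' hy'
    obtain ⟨y, hy, rfl⟩ := Finset.mem_image.1 hy'
    have h1 := (hφW y (hF₀W₀ hy)).2
    have h2 : dist (y + g) g = ‖y‖ := by rw [dist_eq_norm, add_sub_cancel_right]
    linarith [dist_triangle (φ y) (y + g) g, hFn y hy]
  · -- G ⊆ B̄(g, R₀)
    intro x' hx'
    obtain ⟨x, hx, rfl⟩ := Finset.mem_image.1 hx'
    have h2 : dist (x + g) g = ‖x‖ := by rw [dist_eq_norm, add_sub_cancel_right]
    linarith [hGn x hx]
  · -- #G = #F
    rw [Finset.card_image_of_injective G₀ hinjτ, Finset.card_image_of_injOn hinjF, hcard₀]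
  · -- G avoids Y ∖ F
    rw [Set.disjoint_left]
    rintro x' hx'G ⟨hx'Y, hx'F⟩
    obtain ⟨x, hx, rfl⟩ := Finset.mem_image.1 (Finset.mem_coe.1 hx'G)
    have hxg : dist (x + g) g ≤ Rm := by
      rw [dist_eq_norm, add_sub_cancel_right]; linarith [hGn x hx]
    obtain ⟨s, hsY, hds⟩ := hM2 (x + g) hx'Y hxg
    have hxs : dist x s ≤ ε := by rwa [← dist_add_right x s g]
    have hsF : s ∈ F₀ := by
      by_contra hsF
      linarith [hρGY x hx s hsY hsF]
    have hφs := hφW s (hF₀W₀ hsF)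
    have heq : x + g = φ s := hU2 (x + g) hx'Y (φ s) hφs.1 s hds hφs.2
    exact hx'F (Finset.mem_coe.2 (Finset.mem_image.2 ⟨s, hsF, heq.symm⟩))
  · -- W = Y ∩ B̄(g, r)
    ext a'
    rw [Finset.coe_image, Set.mem_image, Set.mem_inter_iff, Metric.mem_closedBall]
    constructor
    · rintro ⟨s, hs, rfl⟩
      have hs' := (hmemW₀ s).1 (Finset.mem_coe.1 hs)
      have hφs := hφW s (Finset.mem_coe.1 hs)
      refine ⟨hφs.1, ?_⟩
      have hsn : ‖s‖ < r - 3 * ε := by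
        rcases hgap s hs'.1 with h | h
        · exact h
        · linarith [hs'.2]
      have h2 : dist (s + g) g = ‖s‖ := by rw [dist_eq_norm, add_sub_cancel_right]
      linarith [dist_triangle (φ s) (s + g) g, hφs.2]
    · rintro ⟨ha'Y, ha'g⟩
      obtain ⟨s, hsY, hds⟩ := hM2 a' ha'Y (by linarith)
      have h2 : dist (s + g) g = ‖s‖ := by rw [dist_eq_norm, add_sub_cancel_right]
      have hsn' : ‖s‖ ≤ r + ε := by linarith [dist_triangle (s + g) a' g, dist_comm a' (s + g)]
      have hsn : ‖s‖ < r - 3 * ε := by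
        rcases hgap s hsY with h | h
        · exact h
        · linarith
      have hsW : s ∈ W₀ := (hmemW₀ s).2 ⟨hsY, by linarith⟩
      have hφs := hφW s hsW
      have heq : a' = φ s := hU2 a' ha'Y (φ s) hφs.1 s hds hφs.2
      exact ⟨s, Finset.mem_coe.2 hsW, heq.symm⟩
  · -- the truncated gain
    have hbase := hT r (hρ.trans hρr) W₀ hW₀
    have hWF : W₀.image φ \ F₀.image φ = (W₀ \ F₀).image φ := (Finset.image_sdiff_of_injOn hinjW hF₀W₀).symm
    have hinjWF : Set.InjOn φ ↑(W₀ \ F₀) := hinjW.mono (Finset.coe_subset.2 Finset.sdiff_subset)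
    -- the four sums over images
    have eF : selfEnergy (F₀.image φ) = 1 / 2 * ∑ y ∈ F₀, ∑ w ∈ F₀, lennardJones (dist (φ y) (φ w)) := by
      unfold selfEnergy
      rw [Finset.sum_image hinjF]
      congr 1
      exact Finset.sum_congr rfl fun y _ => Finset.sum_image hinjF
    have eFW : pairSum (F₀.image φ) (W₀.image φ \ F₀.image φ) = ∑ y ∈ F₀, ∑ w ∈ W₀ \ F₀, lennardJones (dist (φ y) (φ w)) := by
      rw [hWF]; unfold pairSum
      rw [Finset.sum_image hinjF]
      exact Finset.sum_congr rfl fun y _ => Finset.sum_image hinjWF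
    have eG : selfEnergy (G₀.image (fun x => x + g)) = selfEnergy G₀ := by
      unfold selfEnergy
      rw [Finset.sum_image fun x _ y _ h => hinjτ h]
      congr 1
      refine Finset.sum_congr rfl fun x _ => ?_
      rw [Finset.sum_image fun x _ y _ h => hinjτ h]
      exact Finset.sum_congr rfl fun x' _ => by rw [dist_add_right]
    have eGW : pairSum (G₀.image (fun x => x + g)) (W₀.image φ \ F₀.image φ) =
        ∑ x ∈ G₀, ∑ w ∈ W₀ \ F₀, lennardJones (dist (x + g) (φ w)) := by
      rw [hWF]; unfold pairSum
      rw [Finset.sum_image fun x _ y _ h => hinjτ h]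
      exact Finset.sum_congr rfl fun x _ => Finset.sum_image hinjWF
    -- termwise Lipschitz comparisons
    have hpair : ∀ y ∈ W₀, ∀ w ∈ W₀, y ≠ w →
        |lennardJones (dist (φ y) (φ w)) - lennardJones (dist y w)| ≤ L * (2 * ε) := by
      intro y hy w hw hne
      have hy' := (hmemW₀ y).1 hy
      have hw' := (hmemW₀ w).1 hw
      have hφy := hφW y hy
      have hφw := hφW w hw
      have hne' : φ y ≠ φ w := fun h => hne (hinjW (Finset.mem_coe.2 hy) (Finset.mem_coe.2 hw) h)
      exact abs_lennardJones_sub_le_of_abs_le hδ (hsep _ hφy.1 _ hφw.1 hne') (hsep y hy'.1 w hw'.1 hne)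
        (abs_dist_transport hφy.2 hφw.2)
    have d1 : |∑ y ∈ F₀, ∑ w ∈ F₀, lennardJones (dist (φ y) (φ w)) - ∑ y ∈ F₀, ∑ w ∈ F₀, lennardJones (dist y w)| ≤
        F₀.card * (F₀.card * (L * (2 * ε))) := by
      refine abs_sum_sum_sub_le fun y hy w hw => ?_
      by_cases hne : y = w
      · subst hne
        rw [dist_self, dist_self, sub_self, abs_zero]; exact mul_nonneg hL (by linarith)
      · exact hpair y (hF₀W₀ hy) w (hF₀W₀ hw) hne
    have d2 : |∑ y ∈ F₀, ∑ w ∈ W₀ \ F₀, lennardJones (dist (φ y) (φ w)) - ∑ y ∈ F₀, ∑ w ∈ W₀ \ F₀, lennardJones (dist y w)| ≤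
        F₀.card * ((W₀ \ F₀).card * (L * (2 * ε))) := by
      refine abs_sum_sum_sub_le fun y hy w hw => ?_
      have hw' := Finset.mem_sdiff.1 hw
      exact hpair y (hF₀W₀ hy) w hw'.1 (fun h => hw'.2 (h ▸ hy))
    have d3 : |∑ x ∈ G₀, ∑ w ∈ W₀ \ F₀, lennardJones (dist (x + g) (φ w)) - ∑ x ∈ G₀, ∑ w ∈ W₀ \ F₀, lennardJones (dist x w)| ≤
        G₀.card * ((W₀ \ F₀).card * (LG * ε)) := by
      refine abs_sum_sum_sub_le fun x hx w hw => ?_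
      have hw' := Finset.mem_sdiff.1 hw
      have hwY : w ∈ Y := ((hmemW₀ w).1 hw'.1).1
      have hφw := hφW w hw'.1
      have hxw : ρG ≤ dist x w := hρGY x hx w hwY hw'.2
      have hdd : |dist (x + g) (φ w) - dist x w| ≤ ε := by
        rw [← dist_add_right x w g]
        have h2 : |dist (x + g) (φ w) - dist (x + g) (w + g)| ≤ dist (φ w) (w + g) := by
          rw [dist_comm (x + g) (φ w), dist_comm (x + g) (w + g)]; exact abs_dist_sub_le (φ w) (w + g) (x + g)
        exact h2.trans hφw.2
      have hlow : ρG / 2 ≤ dist (x + g) (φ w) := by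
        rw [abs_le] at hdd; linarith [hdd.1]
      exact abs_lennardJones_sub_le_of_abs_le (half_pos hρG) hlow (by linarith) hdd
    -- assemble
    have hG₀c : (G₀.card : ℝ) = F₀.card := by exact_mod_cast hcard₀
    unfold truncGain at hbase ⊢
    rw [eF, eFW, eG, eGW]
    unfold selfEnergy pairSum at hbase
    unfold selfEnergy
    rw [abs_le] at d1 d2 d3
    obtain ⟨d1a, d1b⟩ := d1; obtain ⟨d2a, d2b⟩ := d2; obtain ⟨d3a, d3b⟩ := d3
    have hF0 : (0 : ℝ) ≤ F₀.card := Nat.cast_nonneg _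
    have hb1 : F₀.card * ((W₀ \ F₀).card * (L * (2 * ε))) ≤ F₀.card * (N * (L * (2 * ε))) :=
      mul_le_mul_of_nonneg_left (mul_le_mul_of_nonneg_right hcardW (mul_nonneg hL (by linarith))) hF0
    have hb2 : G₀.card * ((W₀ \ F₀).card * (LG * ε)) ≤ F₀.card * (N * (LG * ε)) := by
      rw [hG₀c]; exact mul_le_mul_of_nonneg_left (mul_le_mul_of_nonneg_right hcardW (mul_nonneg hLG hε.le)) hF0
    have hKε : 1 / 2 * (F₀.card * (F₀.card * (L * (2 * ε)))) + F₀.card * (N * (L * (2 * ε))) + F₀.card * (N * (LG * ε)) = ε * K := by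
      rw [hKdef]; ring
    linarith [hKε, hεK]

/-- **`LocalRelaxationTest T₀ D` holds for all `T₀, D`.** [parts I–IV] -/
theorem localRelaxationTest_holds (T₀ D : ℝ) : LocalRelaxationTest T₀ D :=
  localRelaxationTest_of_transfer (improvementTransfer_holds T₀ D)

/-- the record instance: the RDEF-cone hypothesis `LocalRelaxationTest (1/250) 10`. -/
theorem localRelaxationTest_record : LocalRelaxationTest (1 / 250) 10 := localRelaxationTest_holds _ _

end Summit.AtomisticToContinuum.Crystallization.Theorems.OverbindingBudgetImprovementTransfer

end
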